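import Literature.MathematicalPhysics.QuantumFieldTheory.QCDOS

/-!
# Line `Sketch` for `ChiralDescent` (crux stmt-QuantumFields-17527) — what the OPENNESS stub asserts at a
# "wall" regularisation (lead c1, cycle 2; information for the disprover and the planner)

The registered physics stub H1′ `stub_opennessOfAnalyticMass` of `Cruxes/ChiralDescent/Lines/Sketch.lean` says, for
`N_f ∈ {2,3}` and EVERY mass-scaling regularisation `reg` and EVERY offset `μ`: body above `μ` and one uniform lattice
rate above `μ` imply body above `μ − δ` for some `δ > 0`. The branch clause of `IsQCDAlong` (eventually `−1 < m_f(k)`)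
gives this a hidden NO-GO content, isolated here kernel-checked: along the WALL regularisation
`m_crit(k) = −1 − a_k μ / Z_m(k)` every tuple with some component `≤ μ` runs a flavour at bare mass `≤ −1` for ALL `k`,
so the body fails there (`not_body_at_wall`), and openness can only hold by denying the hypothesis: H1′ implies that
NO wall regularisation carries the body with a uniform lattice gap above `μ`, i.e. lattice QCD with bare masses
`→ −1⁺` (hopping parameter `→ 1/6⁻`) along an asymptotically scaling trajectory has no gapped OS limit with non-trivial
flavour-changing pseudoscalars (`openness_denies_gapped_body_at_wall`). Physically this is expected to be TRUE (quarks
at the cutoff scale decouple; `OSData.IsNontrivial` tests time-SEPARATED arguments, so the flavour-changing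
pseudoscalars of cutoff-mass quarks are trivial and the wall does not carry the body), but it is a statement about an
exotic regime that neither the line nor the tree can decide — recorded so that a disprover attacking H1′ aims here, and so
that a planner promoting H1′ to an item can decide whether to exclude walls by hypothesis (e.g. `m_crit(k) + 1` bounded
away from `0`). Pure bookkeeping over `QCDOS.lean`; standard axioms.
-/

namespace Summit.QuantumFields.QCD.Cruxes.ChiralDescent.InfimumDescent

open Filter
open Literature.MathematicalPhysics.QuantumFieldTheory

variable {Nf : ℕ}

/-- **At a wall regularisation the body fails at every tuple not strictly above the wall.** If
`m_crit(k) = −1 − a_k μ / Z_m(k)` for all `k` and `m_f ≤ μ` for some flavour `f`, then the bare mass of that flavour is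
`−1 + a_k (m_f − μ)/Z_m(k) ≤ −1` for every `k`, so the branch clause `∀ᶠ k, −1 < m_f(k)` of `IsQCDAlong` fails for every
choice of species renormalisations and OS data. [folklore] -/
theorem not_isQCDAlong_at_wall (reg : QCDRegularisation Nf) (μ : ℝ)
    (hwall : ∀ k, reg.mcrit k = -1 - reg.a k * μ / reg.Zm k) {m : Fin Nf → ℝ} {f : Fin Nf} (hf : m f ≤ μ)
    (z shift : QCDField Nf → ℕ → ℝ) (T : OSData (QCDField Nf) 4) :
    ¬ IsQCDAlong (reg.scheme m z shift) T := by
  rintro ⟨-, hbranch, -⟩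
  obtain ⟨k, hk⟩ := (hbranch f).exists
  rw [QCDRegularisation.scheme_mq, hwall k] at hk
  have ha : 0 < reg.a k := reg.a_pos k
  have hZ : 0 < reg.Zm k := reg.Zm_pos k
  have hle : reg.a k * m f / reg.Zm k ≤ reg.a k * μ / reg.Zm k :=
    div_le_div_of_nonneg_right (mul_le_mul_of_nonneg_left hf ha.le) hZ.le
  linarith

/-- **The hidden no-go content of OPENNESS (H1/H1′) at a wall.** If openness holds in the registered generality (every
mass-scaling regularisation, every offset), then for `N_f ∈ {2,3}` no WALL regularisation `m_crit(k) = −1 − a_k μ / Z_m(k)`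
carries the body at every tuple above `μ` together with one uniform lattice rate above `μ`: openness would push the
body to the tuple `(μ − δ/2, …, μ − δ/2)`, where `not_isQCDAlong_at_wall` forbids it. [folklore] -/
theorem openness_denies_gapped_body_at_wall
    (hopen : ∀ Nf : ℕ, (Nf = 2 ∨ Nf = 3) → ∀ reg : QCDRegularisation Nf, reg.HasMassScaling → ∀ μ : ℝ,
      (∀ m : Fin Nf → ℝ, (∀ f, μ < m f) →
        ∃ (z shift : QCDField Nf → ℕ → ℝ) (T : OSData (QCDField Nf) 4),
          IsQCDAlong (reg.scheme m z shift) T ∧ T.IsNontrivial QCDField.glue ∧ T.IsNonGaussian QCDField.glue ∧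
            (∀ f g : Fin Nf, f ≠ g → T.IsNontrivial (QCDField.pseudoRe f g)) ∧
              ∃ Δ > 0, T.HasMassGap Δ ∧ (reg.scheme m z shift).HasLatticeMassGap Δ) →
      (∃ ε > (0 : ℝ), ∀ m : Fin Nf → ℝ, (∀ f, μ < m f) → (reg.scheme m 0 0).HasLatticeMassGap ε) →
      ∃ δ > (0 : ℝ), ∀ m : Fin Nf → ℝ, (∀ f, μ - δ < m f) →
        ∃ (z shift : QCDField Nf → ℕ → ℝ) (T : OSData (QCDField Nf) 4),
          IsQCDAlong (reg.scheme m z shift) T ∧ T.IsNontrivial QCDField.glue ∧ T.IsNonGaussian QCDField.glue ∧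
            (∀ f g : Fin Nf, f ≠ g → T.IsNontrivial (QCDField.pseudoRe f g)) ∧
              ∃ Δ > 0, T.HasMassGap Δ ∧ (reg.scheme m z shift).HasLatticeMassGap Δ)
    (hNf : Nf = 2 ∨ Nf = 3) (reg : QCDRegularisation Nf) (hMS : reg.HasMassScaling) (μ : ℝ)
    (hwall : ∀ k, reg.mcrit k = -1 - reg.a k * μ / reg.Zm k)
    (hbody : ∀ m : Fin Nf → ℝ, (∀ f, μ < m f) →
      ∃ (z shift : QCDField Nf → ℕ → ℝ) (T : OSData (QCDField Nf) 4),
        IsQCDAlong (reg.scheme m z shift) T ∧ T.IsNontrivial QCDField.glue ∧ T.IsNonGaussian QCDField.glue ∧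
          (∀ f g : Fin Nf, f ≠ g → T.IsNontrivial (QCDField.pseudoRe f g)) ∧
            ∃ Δ > 0, T.HasMassGap Δ ∧ (reg.scheme m z shift).HasLatticeMassGap Δ)
    (hgap : ∃ ε > (0 : ℝ), ∀ m : Fin Nf → ℝ, (∀ f, μ < m f) → (reg.scheme m 0 0).HasLatticeMassGap ε) :
    False := by
  obtain ⟨δ, hδ, hbelow⟩ := hopen Nf hNf reg hMS μ hbody hgap
  have hNf0 : 0 < Nf := by rcases hNf with rfl | rfl <;> norm_num
  obtain ⟨z, shift, T, hQ, -⟩ := hbelow (fun _ => μ - δ / 2) fun _ => by linarith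
  exact not_isQCDAlong_at_wall reg μ hwall (m := fun _ => μ - δ / 2) (f := ⟨0, hNf0⟩) (by linarith) z shift T hQ

end Summit.QuantumFields.QCD.Cruxes.ChiralDescent.InfimumDescent
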